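import Literature.MathematicalPhysics.QuantumLattice.HubbardTPPBoxHamiltonian
import Literature.MathematicalPhysics.QuantumLattice.HubbardNNNHoppingClusterEmbedding
import Literature.MathematicalPhysics.QuantumLattice.InfVolFermionStateBounds
import HarnessLib

/-!
# Local cluster floors of an infinite-volume state: kernel sector floors of the open `t–t'–t''` cluster
# bound the box-Hamiltonian expectation of EVERY state from below

Topic `MathematicalPhysics/QuantumLattice`, family `hubbard`. The first atom of the infinite-volume Anderson
bound for object M (the `t–t'–t''` fixed-filling density `tiGroundEnergyDensityAt`): an infinite-volume state
`ω` restricted to a finite region `Λ` is a positive normalised functional on `𝔄_Λ`, hence nonnegative on every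
positive semidefinite local observable (`expect_re_nonneg_of_posSemidef`, `InfVolFermionStateBounds`; §1 turns an operator floor into an expectation floor); a Hermitian, particle-number conserving cluster Hamiltonian `H`
with sector floors `m ≤ E₀(H, N) + μN` in every sector satisfies `H + μN̂ − m ⪰ 0` (§2, the `μ`-twin of
`posSemidef_sub_smul_one_of_forall_le_groundEnergy`); relabelled onto the rectangle `[0, q+1) ⊆ ℤ²` by
`relabel_symm_hubbardOpenBoxTT'T''_eq_localHamiltonian` this gives, for EVERY state `ω` (translation invariance
not needed): `m ≤ Re ω(H^{Ψ(t,t',t'',U)}_{[0,q+1)}) + μ · Re ω(N_{[0,q+1)})` from kernel floors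
`σ_k ≤ E₀(hubbardOpenBoxTT'T'' (q₀+1) (q₁+1) t t' t'' U, k)` and one supporting line `m ≤ σ_k + μk` (§3).
The second atom (the translation-class identity `e(ω) = ω(H^{Ψ'}_{[0,3)×[0,2)}) + ω(H^{Ψ'}_{[0,2)×[0,3)})`,
`Ψ' = Ψ(t/7, t'/4, t''/2, U/12)`) is NOT in this file. Everything is proved; no definition.

## Tree search

REUSED: `posSemidef_sub_smul_one_of_forall_le_groundEnergy`, `posSemidef_relabel`
(`HubbardNNNHoppingClusterEmbedding`); `relabel_symm_hubbardOpenBoxTT'T''_eq_localHamiltonian`,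
`relabel_mapEquiv_totalNumber`, `exists_equiv_polySite_halfOpenRect_two` (`HubbardTPPBoxHamiltonian`);
`groundEnergy_le_re_expect`, `groundEnergySet_nonempty`, `LiebTwo.isNParticle_iff_totalNumber`,
`hubbardOpenBoxTT'_isHermitian`, `hubbardOpenBoxTT'_commute_totalNumber`, `hamiltonian_isHermitian_and_commute_holds`,
`totalNumber_isHermitian`, `card_orb`, `expect_re_nonneg_of_posSemidef` (`InfVolFermionStateBounds`).

## References

* P. W. Anderson, Phys. Rev. 83 (1951) 1260, eq. (2) (cluster lower bounds). [cite: Anderson1951, eq. (2)]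
* O. Bratteli, D. W. Robinson, *OAQSM 1* (1987), §2.3.11 (states are positive functionals). [cite: BratteliRobinsonI1987, Prop. 2.3.11]
* E. Pavarini et al., Phys. Rev. Lett. 87 (2001) 047003, eq. (1). [cite: PavariniEtAl2001, eq. (1)]
-/

namespace Literature.MathematicalPhysics.QuantumLattice

open Matrix HubbardWave0 Literature.Probability.LatticeModels ThermodynamicLimit
open scoped ComplexOrder

/-- `relabel e 1 = 1`, generic rewriting form (at concrete orbital types `map_one` would have to re-synthesise the
matrix-algebra instances). [folklore] -/
private theorem relabel_one_tpp {ι ι' : Type*} [LinearOrder ι] [Fintype ι] [LinearOrder ι'] [Fintype ι']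
    (e : ι ≃ ι') : relabel e (1 : Matrix (Finset ι) (Finset ι) ℂ) = 1 :=
  map_one (relabel e)

/-! ### §1 An infinite-volume state is nonnegative on positive semidefinite local observables -/

namespace InfVolFermionState

variable {d : ℕ} (ω : InfVolFermionState d)

/-- **Operator floor ⇒ expectation floor**: `A − m·1 ⪰ 0` gives `m ≤ Re ω(A)`. [cite: BratteliRobinsonI1987, Prop. 2.3.11] -/
theorem le_re_expect_of_posSemidef_sub_smul_one (Λ : Finset (Site d)) {A : FermionOp Λ} {m : ℝ}
    (h : (A - (m : ℂ) • (1 : FermionOp Λ)).PosSemidef) : m ≤ (ω.expect Λ A).re := by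
  have h0 := ω.expect_re_nonneg_of_posSemidef Λ h
  rw [map_sub, map_smul, ω.expect_one, Complex.sub_re, smul_eq_mul, mul_one, Complex.ofReal_re] at h0
  linarith

/-- **With a number term**: `A + μN_Λ − m·1 ⪰ 0` gives `m ≤ Re ω(A) + μ Re ω(N_Λ)`.
[cite: BratteliRobinsonI1987, Prop. 2.3.11] -/
theorem le_re_expect_add_of_posSemidef (Λ : Finset (Site d)) {A : FermionOp Λ} {m μ : ℝ}
    (h : (A + (μ : ℂ) • (totalNumber : FermionOp Λ) - (m : ℂ) • (1 : FermionOp Λ)).PosSemidef) :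
    m ≤ (ω.expect Λ A).re + μ * (ω.expect Λ (totalNumber : FermionOp Λ)).re := by
  have h0 := ω.le_re_expect_of_posSemidef_sub_smul_one Λ h
  rw [map_add, map_smul, Complex.add_re, smul_eq_mul, Complex.re_ofReal_mul] at h0
  exact h0

end InfVolFermionState

/-! ### §2 Sector floors with a chemical potential give an operator bound -/

section Sectors

variable {Λ : Type*} [LinearOrder Λ] [Fintype Λ]

/-- Rayleigh intro rule for the sector ground energy: a uniform lower bound on the normalised `N`-particle
Rayleigh quotients is a lower bound on `E₀(H, N)` (`N ≤ |orbitals|`). [cite: Anderson1951, eq. (2)] -/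
theorem le_groundEnergy_of_forall_rayleigh (H : Matrix (Finset (Orb Λ)) (Finset (Orb Λ)) ℂ) {N : ℕ}
    (hN : N ≤ Fintype.card (Orb Λ)) {c : ℝ}
    (h : ∀ ψ : Fock (Orb Λ), IsNParticle N ψ → star ψ ⬝ᵥ ψ = 1 → c ≤ (expect H ψ).re) :
    c ≤ groundEnergy H N := by
  unfold groundEnergy
  refine le_csInf (groundEnergySet_nonempty H hN) ?_
  rintro E ⟨ψ, hψN, hψ1, rfl⟩
  exact h ψ hψN hψ1

/-- **Sector floors of `H + μN̂` from sector floors of `H`**: `E₀(H, N) + μN ≤ E₀(H + μN̂, N)`.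
[cite: Anderson1951, eq. (2)] -/
theorem groundEnergy_add_mul_le_groundEnergy_add_smul_totalNumber (H : Matrix (Finset (Orb Λ)) (Finset (Orb Λ)) ℂ)
    (μ : ℝ) {N : ℕ} (hN : N ≤ Fintype.card (Orb Λ)) :
    groundEnergy H N + μ * N ≤ groundEnergy (H + (μ : ℂ) • (totalNumber : Matrix (Finset (Orb Λ)) (Finset (Orb Λ)) ℂ)) N := by
  refine le_groundEnergy_of_forall_rayleigh _ hN fun ψ hψN hψ1 => ?_
  have hE := groundEnergy_le_re_expect H hψN hψ1
  have hNψ : (totalNumber : Matrix (Finset (Orb Λ)) (Finset (Orb Λ)) ℂ) *ᵥ ψ = (N : ℂ) • ψ :=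
    (LiebTwo.isNParticle_iff_totalNumber N ψ).1 hψN
  have hexp : expect (H + (μ : ℂ) • (totalNumber : Matrix (Finset (Orb Λ)) (Finset (Orb Λ)) ℂ)) ψ =
      expect H ψ + (μ : ℂ) * (N : ℂ) := by
    unfold expect
    rw [add_mulVec, smul_mulVec, hNψ, dotProduct_add, dotProduct_smul, dotProduct_smul, hψ1, smul_eq_mul,
      smul_eq_mul, mul_one]
  rw [hexp, Complex.add_re]
  have hre : ((μ : ℂ) * (N : ℂ)).re = μ * N := by
    rw [← Complex.ofReal_natCast, ← Complex.ofReal_mul, Complex.ofReal_re]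
  rw [hre]
  linarith

/-- **Uniform sector bounds with a chemical potential give an operator bound**: a Hermitian, particle-number
conserving `H` with `m ≤ E₀(H, N) + μN` in every sector `N ≤ 2|Λ|` satisfies `H + μN̂ − m·1 ⪰ 0`.
[cite: Anderson1951, eq. (2)] -/
theorem posSemidef_add_smul_totalNumber_sub_of_forall_le_groundEnergy
    {H : Matrix (Finset (Orb Λ)) (Finset (Orb Λ)) ℂ} (hH : H.IsHermitian)
    (hHN : Commute H totalNumber) {m μ : ℝ} (hm : ∀ N ≤ 2 * Fintype.card Λ, m ≤ groundEnergy H N + μ * N) :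
    (H + (μ : ℂ) • (totalNumber : Matrix (Finset (Orb Λ)) (Finset (Orb Λ)) ℂ) -
      (m : ℂ) • (1 : Matrix (Finset (Orb Λ)) (Finset (Orb Λ)) ℂ)).PosSemidef := by
  have hH' : (H + (μ : ℂ) • (totalNumber : Matrix (Finset (Orb Λ)) (Finset (Orb Λ)) ℂ)).IsHermitian :=
    hH.add (totalNumber_isHermitian.smul (by rw [isSelfAdjoint_iff, Complex.star_def, Complex.conj_ofReal]))
  have hHN' : Commute (H + (μ : ℂ) • (totalNumber : Matrix (Finset (Orb Λ)) (Finset (Orb Λ)) ℂ)) totalNumber :=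
    hHN.add_left ((Commute.refl _).smul_left _)
  refine posSemidef_sub_smul_one_of_forall_le_groundEnergy hH' hHN' fun N hN => ?_
  have hN' : N ≤ Fintype.card (Orb Λ) := by rw [card_orb]; exact hN
  exact (hm N hN).trans (groundEnergy_add_mul_le_groundEnergy_add_smul_totalNumber H μ hN')

end Sectors

/-! ### §3 The open `t–t'–t''` cluster relabelled onto a rectangle of `ℤ²`: floors for every state -/

section Cluster

/-- The open `t–t'–t''` cluster Hamiltonian is Hermitian. [cite: PavariniEtAl2001, eq. (1)] -/
theorem hubbardOpenBoxTT'T''_isHermitian (a b : ℕ) (t t' t'' U : ℝ) :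
    (hubbardOpenBoxTT'T'' a b t t' t'' U).IsHermitian := by
  rw [hubbardOpenBoxTT'T''_def]
  exact (hubbardOpenBoxTT'_isHermitian a b t t' U).add
    (hamiltonian_isHermitian_and_commute_holds (rectBoxAxial2Graph a b) t'' 0).1

/-- The open `t–t'–t''` cluster Hamiltonian conserves the particle number. [cite: PavariniEtAl2001, eq. (1)] -/
theorem hubbardOpenBoxTT'T''_commute_totalNumber (a b : ℕ) (t t' t'' U : ℝ) :
    Commute (hubbardOpenBoxTT'T'' a b t t' t'' U) totalNumber := by
  rw [hubbardOpenBoxTT'T''_def]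
  exact (hubbardOpenBoxTT'_commute_totalNumber a b t t' U).add_left
    (hamiltonian_isHermitian_and_commute_holds (rectBoxAxial2Graph a b) t'' 0).2.1

/-- **KERNEL SECTOR FLOORS ⇒ A FLOOR FOR EVERY STATE on the rectangle `[0, q+1)`.** Sector floors
`σ_k ≤ E₀(hubbardOpenBoxTT'T'' (q₀+1) (q₁+1) t t' t'' U, k)` (`k ≤ 2(q₀+1)(q₁+1)`; the shape a kernel certificate
delivers) and one supporting line `m ≤ σ_k + μk` give, for EVERY infinite-volume state `ω` of the lattice fermions
on `ℤ²`: `m ≤ Re ω(H^{Ψ(t,t',t'',U)}_{[0,q+1)}) + μ · Re ω(N_{[0,q+1)})` (`H^Ψ_Λ` the free-boundary box Hamiltonian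
of the `t–t'–t''` interaction, `N_Λ` the box's particle number). [cite: Anderson1951, eq. (2)] [cite: PavariniEtAl2001, eq. (1)] -/
theorem InfVolFermionState.le_re_expect_localHamiltonian_tpp_of_sectorFloors (ω : InfVolFermionState 2)
    (q : Fin 2 → ℕ) (t t' t'' U : ℝ) {σ : ℕ → ℝ}
    (hF : ∀ k ≤ 2 * ((q 0 + 1) * (q 1 + 1)), σ k ≤ groundEnergy (hubbardOpenBoxTT'T'' (q 0 + 1) (q 1 + 1) t t' t'' U) k)
    (μ m : ℝ) (hm : ∀ k ≤ 2 * ((q 0 + 1) * (q 1 + 1)), m ≤ σ k + μ * k) :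
    m ≤ (ω.expect (halfOpenRect q) ((hubbardTT'T''FermionInteraction t t' t'' U).localHamiltonian (halfOpenRect q))).re +
      μ * (ω.expect (halfOpenRect q) (totalNumber : FermionOp (halfOpenRect q))).re := by
  classical
  obtain ⟨f, hf0, hf1⟩ := exists_equiv_polySite_halfOpenRect_two q
  -- the cluster operator bound
  have hcard : Fintype.card (Fin (q 0 + 1) ×ₗ Fin (q 1 + 1)) = (q 0 + 1) * (q 1 + 1) := by
    rw [Fintype.card_lex, Fintype.card_prod, Fintype.card_fin, Fintype.card_fin]
  have hpsd := posSemidef_add_smul_totalNumber_sub_of_forall_le_groundEnergy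
    (hubbardOpenBoxTT'T''_isHermitian (q 0 + 1) (q 1 + 1) t t' t'' U)
    (hubbardOpenBoxTT'T''_commute_totalNumber (q 0 + 1) (q 1 + 1) t t' t'' U) (m := m) (μ := μ)
    (fun N hN => by
      rw [hcard] at hN
      exact (hm N hN).trans (by linarith [hF N hN]))
  -- relabel onto the rectangle
  have hrel := posSemidef_relabel (Orb.mapEquiv f.symm) hpsd
  rw [relabel_sub, relabel_add, relabel_smul, relabel_smul, relabel_mapEquiv_totalNumber,
    relabel_symm_hubbardOpenBoxTT'T''_eq_localHamiltonian q f hf0 hf1] at hrel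
  rw [relabel_one_tpp] at hrel
  exact ω.le_re_expect_add_of_posSemidef (halfOpenRect q) hrel

end Cluster

end Literature.MathematicalPhysics.QuantumLattice
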